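import Summits.BirchSwinnertonDyer.BirchSwinnertonDyer.Theorems.CMKolyvaginAtInertTwoFrobeniusBridgeAtTwo
import Summits.BirchSwinnertonDyer.BirchSwinnertonDyer.Theorems.CMKolyvaginAtInertTwoTauPartDescentAtTwo
import HarnessLib

/-!
# Route `CMKolyvaginAtInertTwo`, crux `CMKolyvaginExactAtInertTwo` (stmt-BirchSwinnertonDyer-24277):
# on the habitat H₂ every Kolyvagin prime of `(2, 1)` in GROSS'S form is INERT in the CM field `F`
# (the converse of the `p = 2` Frobenius bridge p593158/p593502)

Seat `bsd-line-cmk2-p1` g6 (cell `bsd-print-cf2`); helper (`--supports stmt-BirchSwinnertonDyer-24277`).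
THEOREMS ONLY: no definition, no named fact, no `sorry`; no item is closed; BSD is not proved by this.

WHY. The route's items (rev 8, memo R6) type Kolyvagin primes at `2` as W. Zhang's congruence form
conjoined with `Rank1Residual.CMInert W ℓ`; ty2's binders (p601266 §4) accordingly carry the support
`S := CMInert W`; the kernel machine and the `τ`-part descent at `2` (p608079) consume Gross's form
`IsKolyvaginPrime N W K 2 ℓ` (an arithmetic Frobenius above `ℓ` acts on `E[2]` and on `K` as a complex
conjugation). g3 proved «Zhang form ∧ `CMInert W ℓ` ⟹ Gross form» (p593502). This file proves the
CONVERSE on H₂, so that full-support and `CMInert`-support binders are interchangeable there: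

* `smul_eq_neg_of_sq_eq_algebraMap_of_neg` — a complex conjugation `c₀ ∈ Γ_ℚ` NEGATES every `z ∈ ℚ̄`
  with `z² = r`, `r < 0` rational (`ι(c₀ z) = conj(ι z)` and `(ι z)² < 0` forces `ι z ∈ iℝ`).
* `smul_root_eq_of_forall_twoTorsion_smul_eq` — two elements of `Γ_ℚ` acting alike on `E(ℚ̄)[2]` act
  alike on the roots of the `2`-division cubic (abscissae of the `2`-torsion points, g2's
  `exists_point_two_smul_eq_zero_of_isRoot`).
* `cmInert_of_isKolyvaginPrime_two` (**main**) — `W` globally minimal with CM, `CMInert W 2`, `ρ̄_{W,2}`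
  onto, `K` a number field, `ℓ` a Kolyvagin prime of `(2, 1)` for `(N_E, W, K)` in Gross's form ⟹
  **`CMInert W ℓ`**. Proof: `Δ = d_F s²` with `d_F ∈ {−3, −11, −19, −43, −67, −163}` (p593502
  `exists_Δ_eq_cmFieldDiscr_mul_sq_of_cmInert_two`); `ℓ ∤ d_F` (else `ℓ = |d_F|` divides
  `Δ_min·den(s)² = d_F·num(s)²` twice, against `ℓ ∤ Δ_min` = good reduction at `ℓ ∤ N_E`); if `d_F` were
  a square mod `ℓ`, the Frobenius `h` would FIX `t = √d_F` (`DeuringLadic.smul_eq_self_of_isArithFrobAt`),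
  but `h` acts on `E[2]`, hence on the roots `e_i` and on `δ = 16∏(e_i − e_j) = ±4st`, as `c₀`, which
  negates `δ` (`δ² = 16Δ < 0`): `t = −t`, `d_F = 0`, absurd.
* `hpoints_top_of_cmInert_two` / `hRT_top_of_cmInert_two` — consequently, on H₂ with `N = N_E`, ty2's
  DATA with support `CMInert W` (`PointSystemFamily N_E W K P 2 (CMInert W)`,
  `ReciprocityFamily N_E W K 2 (CMInert W)`) already yield the FULL-support binders at `M = 1` that
  `KolyvaginDescentTwo.conjAct_eq_self_of_mem_selmerGroup_two` consumes (instantiate `q := 2 ^ 1`).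

References: [GrossLMS1991] §3 (3.1)–(3.3); [SilvermanAEC2009] III.1 (`disc = 16Δ`), VII.5.1;
[NeukirchANT1999] I §8 (8.5); [Cox2013] Prop. 5.16 / Cor. 5.17 (inert ⟺ non-residue).
-/

-- single-conjunct summit: `Summit.BirchSwinnertonDyer.BirchSwinnertonDyer.…` repeats the name by design
set_option linter.dupNamespace false
set_option autoImplicit false

noncomputable section

open scoped Classical Pointwise

namespace Summit.BirchSwinnertonDyer.BirchSwinnertonDyer.Theorems.KolyvaginDescentTwo

open WeierstrassCurve Field NumberField IsDedekindDomain Rat.HeightOneSpectrum Polynomial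
open Literature.NumberTheory.EllipticCurves Literature.NumberTheory.GaloisRepresentations
open Literature.NumberTheory.EllipticCurves.Rank1Residual
open Summit.BirchSwinnertonDyer.BirchSwinnertonDyer.Theorems.KolyvaginEigenTwo
open Summit.BirchSwinnertonDyer.BirchSwinnertonDyer.Theorems.KolyvaginFrobeniusTwo

/-! ## §1 Complex conjugation negates square roots of negative rationals; Galois elements agreeing on `E[2]` -/

/-- **A complex conjugation of `ℚ̄` negates `√r` for `r < 0` rational**: if `c₀ ∈ Γ_ℚ` is a complex
conjugation (for `ℚ ⊂ ℝ`) and `z² = r` with `r < 0`, then `c₀ • z = −z` (under `ι : ℚ̄ → ℂ` with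
`ι ∘ c₀ = conj ∘ ι`, `(ι z)² = r < 0` forces `Re ι z = 0`). [folklore] -/
theorem smul_eq_neg_of_sq_eq_algebraMap_of_neg {c₀ : absoluteGaloisGroup ℚ}
    (hc₀ : IsComplexConjugation (Rat.castHom ℝ) c₀) {z : AlgebraicClosure ℚ} {r : ℚ} (hr : r < 0)
    (hz : z ^ 2 = algebraMap ℚ (AlgebraicClosure ℚ) r) : c₀ • z = -z := by
  obtain ⟨ι, -, hι⟩ := isComplexConjugation_iff.mp hc₀
  set w : ℂ := ι z with hw
  have hw2 : w ^ 2 = (r : ℂ) := by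
    have h := congrArg ι hz
    rw [map_pow, eq_ratCast, map_ratCast] at h
    exact h
  have hre2 : w.re * w.re - w.im * w.im = (r : ℝ) := by
    have h := congrArg Complex.re hw2
    rw [pow_two, Complex.mul_re, Complex.ratCast_re] at h
    exact h
  have him2 : w.re * w.im + w.im * w.re = 0 := by
    have h := congrArg Complex.im hw2
    rw [pow_two, Complex.mul_im, Complex.ratCast_im] at h
    exact h
  have hr' : (r : ℝ) < 0 := by exact_mod_cast hr
  have hre : w.re = 0 := by
    by_contra hne
    have him : w.im = 0 := by
      have : 2 * w.re * w.im = 0 := by linarith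
      rcases mul_eq_zero.mp this with h | h
      · exact absurd (by linarith : w.re = 0) hne
      · exact h
    rw [him, mul_zero, sub_zero] at hre2
    nlinarith [mul_self_nonneg w.re]
  have hconj : starRingEnd ℂ w = -w := by
    apply Complex.ext
    · rw [Complex.conj_re, Complex.neg_re, hre, neg_zero]
    · rw [Complex.conj_im, Complex.neg_im]
  apply ι.injective
  rw [hι, ← hw, hconj, map_neg]

variable (W : WeierstrassCurve ℚ) [W.IsElliptic]

omit [W.IsElliptic] in
/-- The `2`-division cubic commutes with base change to `ℚ̄`, as a `Cubic` (copy of g3's private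
lemma). [folklore] -/
private theorem twoTorsionPolynomial_baseChange_eq_map' :
    (W.baseChange (AlgebraicClosure ℚ)).twoTorsionPolynomial =
      Cubic.map (algebraMap ℚ (AlgebraicClosure ℚ)) W.twoTorsionPolynomial := by
  simp [baseChange, twoTorsionPolynomial, Cubic.map, map_b₂, map_b₄, map_b₆, map_ofNat]

/-- **Two elements of `Γ_ℚ` acting alike on `E(ℚ̄)[2]` act alike on every root of the `2`-division
cubic** (a root `e` is the abscissa of a point of order `2`, g2's
`KolyvaginEigenTwo.exists_point_two_smul_eq_zero_of_isRoot`; `Γ_ℚ` acts on points coordinatewise).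
[cite: SilvermanAEC2009, III.1 and III.2.3(d)] -/
theorem smul_root_eq_of_forall_twoTorsion_smul_eq {σ σ' : absoluteGaloisGroup ℚ}
    (hall : ∀ v : geomTorsion W ((2 : ℕ) : ℤ), σ • v = σ' • v) {e : AlgebraicClosure ℚ}
    (he : e ∈ (Cubic.map (algebraMap ℚ (AlgebraicClosure ℚ)) W.twoTorsionPolynomial).roots) :
    σ • e = σ' • e := by
  have ha : W.twoTorsionPolynomial.a ≠ 0 := by change (4 : ℚ) ≠ 0; norm_num
  have ha' : (Cubic.map (algebraMap ℚ (AlgebraicClosure ℚ)) W.twoTorsionPolynomial).a ≠ 0 := by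
    change algebraMap ℚ (AlgebraicClosure ℚ) W.twoTorsionPolynomial.a ≠ 0
    exact (_root_.map_ne_zero _).mpr ha
  have hne0 : (Cubic.map (algebraMap ℚ (AlgebraicClosure ℚ)) W.twoTorsionPolynomial).toPoly ≠ 0 :=
    Cubic.ne_zero_of_a_ne_zero ha'
  have hroot : (Cubic.map (algebraMap ℚ (AlgebraicClosure ℚ)) W.twoTorsionPolynomial).toPoly.IsRoot e :=
    (mem_roots hne0).mp he
  rw [← twoTorsionPolynomial_baseChange_eq_map'] at hroot
  obtain ⟨y, hns, h2⟩ := exists_point_two_smul_eq_zero_of_isRoot W hroot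
  set P : geomPoints W := Affine.Point.some e y hns with hP
  have hPmem : P ∈ geomTorsion W ((2 : ℕ) : ℤ) := by
    rw [mem_geomTorsion_iff, Nat.cast_ofNat]; exact h2
  have hv := hall ⟨P, hPmem⟩
  have hv' : σ • P = σ' • P := congrArg Subtype.val hv
  have hmap : σ • P = Affine.Point.map ((absoluteGaloisGroup.toAlgEquiv ℚ σ).toAlgHom) P := rfl
  have hmap' : σ' • P = Affine.Point.map ((absoluteGaloisGroup.toAlgEquiv ℚ σ').toAlgHom) P := rfl
  rw [hmap, hmap', hP, Affine.Point.map_some, Affine.Point.map_some] at hv'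
  injection hv' with hx hy

/-- **Two elements of `Γ_ℚ` acting alike on `E(ℚ̄)[2]` act alike on a square root `δ` of `16Δ_E`**,
`δ = 16(e₁−e₂)(e₁−e₃)(e₂−e₃)` (`δ² = disc = 16Δ`, Mathlib `Cubic.discr_eq_prod_three_roots`,
`twoTorsionPolynomial_discr`). [cite: SilvermanAEC2009, III.1] -/
theorem exists_sqrt_discr_smul_eq_smul_of_forall_twoTorsion_smul_eq {σ σ' : absoluteGaloisGroup ℚ}
    (hall : ∀ v : geomTorsion W ((2 : ℕ) : ℤ), σ • v = σ' • v) :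
    ∃ δ : AlgebraicClosure ℚ, δ ^ 2 = algebraMap ℚ (AlgebraicClosure ℚ) (16 * W.Δ) ∧ σ • δ = σ' • δ := by
  have ha : W.twoTorsionPolynomial.a ≠ 0 := by change (4 : ℚ) ≠ 0; norm_num
  have hsplit : (W.twoTorsionPolynomial.toPoly.map (algebraMap ℚ (AlgebraicClosure ℚ))).Splits :=
    IsAlgClosed.splits _
  obtain ⟨e₁, e₂, e₃, h3⟩ := (Cubic.splits_iff_roots_eq_three ha).mp hsplit
  have h1 : σ • e₁ = σ' • e₁ := smul_root_eq_of_forall_twoTorsion_smul_eq W hall (by rw [h3]; simp)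
  have h2 : σ • e₂ = σ' • e₂ := smul_root_eq_of_forall_twoTorsion_smul_eq W hall (by rw [h3]; simp)
  have h3' : σ • e₃ = σ' • e₃ := smul_root_eq_of_forall_twoTorsion_smul_eq W hall (by rw [h3]; simp)
  have hdisc := Cubic.discr_eq_prod_three_roots ha h3
  rw [twoTorsionPolynomial_discr] at hdisc
  have ha4 : W.twoTorsionPolynomial.a = 4 := rfl
  rw [ha4] at hdisc
  have h44 : algebraMap ℚ (AlgebraicClosure ℚ) 4 = 4 := map_ofNat _ 4
  rw [h44] at hdisc
  refine ⟨4 * 4 * (e₁ - e₂) * (e₁ - e₃) * (e₂ - e₃), hdisc.symm, ?_⟩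
  have h4 : σ • (4 : AlgebraicClosure ℚ) = 4 := by rw [absoluteGaloisGroup.smul_def, map_ofNat]
  have h4' : σ' • (4 : AlgebraicClosure ℚ) = 4 := by rw [absoluteGaloisGroup.smul_def, map_ofNat]
  simp only [smul_mul', smul_sub, h1, h2, h3', h4, h4']

/-! ## §2 On H₂: `ℓ ∤ d_F` at a good odd prime, and the main theorem -/

/-- **On H₂, a prime `ℓ` of good reduction does not divide `d_F`.** `W` globally minimal with CM,
`CMInert W 2`, `ρ̄_{W,2}` onto (so `Δ = d_F·s²`, `|d_F| ∈ {3, 11, 19, 43, 67, 163}` prime): if `ℓ ∣ d_F`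
then `ℓ = |d_F|` and `Δ_min·den(s)² = d_F·num(s)²` gives `ℓ ∣ den(s)`, `ℓ² ∣ d_F·num(s)²`, `ℓ ∣ num(s)`
— against `gcd(num, den) = 1`; here `ℓ ∤ Δ_min` is good reduction. (Equivalently: the primes ramified
in `F` divide `N_E`.) [cite: SilvermanAEC2009, VII.5.1] [cite: SilvermanATAEC1994, App. A §3] -/
theorem not_dvd_cmFieldDiscr_of_hasGoodReductionAtPrime [W.IsGloballyMinimal] (hCM : W.HasCM)
    (hin : CMInert W 2) (hsurj : W.HasSurjectiveModNGaloisRep 2) {ℓ : ℕ} [Fact ℓ.Prime]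
    (hgood : W.HasGoodReductionAtPrime ℓ) : ¬ (ℓ : ℤ) ∣ cmFieldDiscrOfJ W.j := by
  have hℓ : ℓ.Prime := Fact.out
  have hℓ' : Prime (ℓ : ℤ) := Nat.prime_iff_prime_int.mp hℓ
  have hℓ0 : (ℓ : ℤ) ≠ 0 := by exact_mod_cast hℓ.ne_zero
  obtain ⟨-, s, hΔ⟩ := exists_Δ_eq_cmFieldDiscr_mul_sq_of_cmInert_two W hCM hin hsurj
  intro hℓd
  -- `|d_F|` is prime, so `d_F = ± ℓ`
  have hdabs : (cmFieldDiscrOfJ W.j).natAbs.Prime := by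
    rcases cmFieldDiscrOfJ_mem_of_cmInert_two W hin with h | h | h | h | h | h <;> rw [h] <;> norm_num
  have hℓnat : ℓ ∣ (cmFieldDiscrOfJ W.j).natAbs := by
    rwa [← Int.natCast_dvd_natCast, Int.natCast_natAbs, dvd_abs]
  have hℓeq : (cmFieldDiscrOfJ W.j).natAbs = ℓ := ((Nat.prime_dvd_prime_iff_eq hℓ hdabs).mp hℓnat).symm
  -- `Δ_min · den² = d_F · num²`, `ℓ ∤ Δ_min`
  set D : ℤ := minimalDiscriminantInt W with hD
  have hDΔ : (D : ℚ) = W.Δ := cast_minimalDiscriminantInt W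
  have hℓD : ¬ (ℓ : ℤ) ∣ D := W.not_dvd_minimalDiscriminantInt_of_hasGoodReductionAtPrime ℓ hgood
  have hrel : D * (s.den : ℤ) ^ 2 = cmFieldDiscrOfJ W.j * s.num ^ 2 := by
    have h1 : (D : ℚ) * (s.den : ℚ) ^ 2 = cmFieldDiscrOfJ W.j * (s.num : ℚ) ^ 2 := by
      rw [hDΔ, hΔ, ← Rat.mul_den_eq_num s]; ring
    exact_mod_cast h1
  have hcop : IsCoprime s.num (s.den : ℤ) := by
    rw [Int.isCoprime_iff_gcd_eq_one]
    exact_mod_cast s.reduced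
  -- `ℓ ∣ den`
  have h1 : (ℓ : ℤ) ∣ D * (s.den : ℤ) ^ 2 := by rw [hrel]; exact dvd_mul_of_dvd_left hℓd _
  have hden : (ℓ : ℤ) ∣ (s.den : ℤ) := hℓ'.dvd_of_dvd_pow ((hℓ'.dvd_or_dvd h1).resolve_left hℓD)
  -- `ℓ² ∣ d_F · num² = ± ℓ · num²`, so `ℓ ∣ num`
  have h2 : (ℓ : ℤ) * ℓ ∣ cmFieldDiscrOfJ W.j * s.num ^ 2 := by
    rw [← hrel, ← pow_two]; exact dvd_mul_of_dvd_right (pow_dvd_pow_of_dvd hden 2) _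
  have hnum2 : (ℓ : ℤ) ∣ s.num ^ 2 := by
    rcases Int.natAbs_eq_iff.mp hℓeq with hdl | hdl
    · rw [hdl] at h2; exact (mul_dvd_mul_iff_left hℓ0).mp h2
    · rw [hdl, neg_mul, dvd_neg] at h2; exact (mul_dvd_mul_iff_left hℓ0).mp h2
  have hnum : (ℓ : ℤ) ∣ s.num := hℓ'.dvd_of_dvd_pow hnum2
  exact hℓ'.not_unit (hcop.isUnit_of_dvd' hnum hden)

/-- **MAIN: on H₂ a Gross-form Kolyvagin prime of `(2, 1)` is inert in the CM field.** `W/ℚ` globally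
minimal with CM, `2` inert in `F` (`CMInert W 2`), `ρ̄_{W,2}` onto, `K` a number field, and `ℓ` with
`IsKolyvaginPrime (N_E) W K 2 ℓ` (Gross (3.1)–(3.2): `ℓ ∤ 2 N_E d_K`, `(ℓ)` prime in `𝓞_K`, an
arithmetic Frobenius above `ℓ` acts on `E[2]` and on `K` as a complex conjugation). Then
**`CMInert W ℓ`**: `ℓ ∤ d_F` (good reduction) and `d_F` is a non-square mod `ℓ` — otherwise the
Frobenius fixes `√d_F` (`DeuringLadic.smul_eq_self_of_isArithFrobAt`) while, acting on the roots of
the `2`-division cubic like complex conjugation, it negates `δ = √(16Δ) = ±4s·√d_F` (`16Δ < 0`).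
Converse of p593502's `frobEqFrobInfty_two_of_cmInert`. [cite: GrossLMS1991, §3 (3.1)–(3.3)]
[cite: Cox2013, Prop. 5.16] [cite: SilvermanAEC2009, III.1, VII.5.1] -/
theorem cmInert_of_isKolyvaginPrime_two [W.IsGloballyMinimal] (hCM : W.HasCM) (hin : CMInert W 2)
    (hsurj : W.HasSurjectiveModNGaloisRep 2) {K : Type} [Field K] [NumberField K] {ℓ : ℕ}
    (hℓK : IsKolyvaginPrime (W.conductorNorm ℤ) W K 2 ℓ) : CMInert W ℓ := by
  obtain ⟨hℓp, hℓN, -, hℓ2, -, v, 𝔓, h, c₀, hℓv, h𝔓, hh, hc₀, hE, -⟩ := hℓK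
  haveI : Fact ℓ.Prime := ⟨hℓp⟩
  have hvℓ : (primesEquiv v : ℕ) = ℓ := primesEquiv_eq_of_natCast_mem hℓp hℓv
  have hgood₁ : W.HasGoodReductionAt v :=
    Summit.BirchSwinnertonDyer.Rank1Residual.X11b.Three.Koly.Method2.LocalFrob.hasGoodReductionAt_rat_of_not_dvd_conductorNorm
      W hℓp hℓN v hℓv
  have hgood : W.HasGoodReductionAtPrime ℓ :=
    (hasGoodReductionAtPrime_primesEquiv_iff_holds W v ℓ hvℓ).mpr hgood₁
  have hℓd := not_dvd_cmFieldDiscr_of_hasGoodReductionAtPrime W hCM hin hsurj hgood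
  refine ⟨hℓd, fun hsplit ↦ ?_⟩
  obtain ⟨-, hsq⟩ := hsplit
  rw [if_neg hℓ2] at hsq
  -- `Δ = d_F s²`; the Frobenius `h` fixes `t = √d_F`
  obtain ⟨-, s, hΔ⟩ := exists_Δ_eq_cmFieldDiscr_mul_sq_of_cmInert_two W hCM hin hsurj
  obtain ⟨t, ht⟩ := IsAlgClosed.exists_pow_nat_eq ((cmFieldDiscrOfJ W.j : ℤ) : AlgebraicClosure ℚ) two_pos
  have hfix : h • t = t := DeuringLadic.smul_eq_self_of_isArithFrobAt hℓp hℓ2 hℓd hsq ht hvℓ h𝔓 hh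
  -- `δ = √(16Δ)` with `h δ = c₀ δ = −δ`
  obtain ⟨δ, hδ2, hδ⟩ := exists_sqrt_discr_smul_eq_smul_of_forall_twoTorsion_smul_eq W hE
  have hΔneg : W.Δ < 0 := Δ_neg_of_cmInert_two W hCM hin hsurj
  have hcδ : c₀ • δ = -δ :=
    smul_eq_neg_of_sq_eq_algebraMap_of_neg hc₀ (by linarith : 16 * W.Δ < 0) hδ2
  -- `δ = ± a t` with `a = 4 s ∈ ℚ`, `a ≠ 0`
  set a : AlgebraicClosure ℚ := algebraMap ℚ (AlgebraicClosure ℚ) (4 * s) with ha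
  have hΔ0 : W.Δ ≠ 0 := by rw [← coe_Δ']; exact W.Δ'.ne_zero
  have hs0 : s ≠ 0 := by
    rintro rfl
    apply hΔ0
    rw [hΔ]; ring
  have ha0 : a ≠ 0 := by
    rw [ha, map_ne_zero_iff _ (algebraMap ℚ (AlgebraicClosure ℚ)).injective]
    exact mul_ne_zero four_ne_zero hs0
  have hsq' : δ ^ 2 = (a * t) ^ 2 := by
    rw [hδ2, hΔ, mul_pow, ht, ha, ← map_pow, ← map_intCast (algebraMap ℚ (AlgebraicClosure ℚ)),
      ← map_mul]
    congr 1
    ring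
  have hha : h • a = a := by rw [ha, absoluteGaloisGroup.smul_def, eq_ratCast, map_ratCast]
  have hat : h • (a * t) = -(a * t) := by
    rcases sq_eq_sq_iff_eq_or_eq_neg.mp hsq' with hδt | hδt
    · rw [← hδt, hδ, hcδ]
    · have h1 : a * t = -δ := by rw [hδt, neg_neg]
      rw [h1, smul_neg, hδ, hcδ]
  -- hence `a t = −a t`, `t = 0`, `d_F = 0`: absurd
  rw [smul_mul', hha, hfix] at hat
  have hat0 : a * t = 0 := by
    have h2 : (2 : AlgebraicClosure ℚ) * (a * t) = 0 := by rw [two_mul]; nth_rw 2 [hat]; exact add_neg_cancel _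
    exact (mul_eq_zero.mp h2).resolve_left two_ne_zero
  have ht0 : t = 0 := (mul_eq_zero.mp hat0).resolve_left ha0
  have hd0 : ((cmFieldDiscrOfJ W.j : ℤ) : AlgebraicClosure ℚ) = 0 := by rw [← ht, ht0]; ring
  have hd0' : cmFieldDiscrOfJ W.j = 0 := by exact_mod_cast hd0
  exact hℓd (hd0' ▸ dvd_zero _)

/-! ## §3 Consequence: the `τ`-part descent at `2` consumes the route's `CMInert`-supported data -/

/-- **The `τ`-part descent at `2` from ty2's `CMInert`-supported DATA** (p601266 §4, the support of
route rev 8): on H₂ (`W` globally minimal with CM, `CMInert W 2`, `ρ̄_{W,2}` onto), `K` imaginary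
quadratic with the Heegner hypothesis for `N_E`, `P ∈ E(K)` a Heegner point of level `N_E` with
`P ∉ 2E(K)`, a point-system family and a reciprocity family at `p = 2` supported on the CM-inert
Kolyvagin primes (used at `M = 1` only) ⟹ `c_* s = s` on `Sel₂(E/K)`. By `cmInert_of_isKolyvaginPrime_two`
every Gross-form Kolyvagin prime of `(2, 1)` for `N_E` IS CM-inert, so the `CMInert`-supported binders
are the full-support ones that `KolyvaginDescentTwo.conjAct_eq_self_of_cmInert_two_of_heegner` takes.
[cite: GrossLMS1991, Prop. 2.1 with §10 (proof), §3 (3.1)–(3.3)] [cite: McCallumLMS1991, §2 Prop. 2.2, §5 Lemma 5.3] -/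
theorem conjAct_eq_self_of_cmInert_families_two [W.IsGloballyMinimal] [NeZero (W.conductorNorm ℤ)]
    (hCM : W.HasCM) (hin : CMInert W 2) (hsurj : W.HasSurjectiveModNGaloisRep 2)
    {K : Type} [Field K] [NumberField K] (hK : IsImaginaryQuadratic K)
    (hH : SatisfiesHeegnerHypothesis (W.conductorNorm ℤ) K)
    {P : (W.baseChange K).toAffine.Point} (hP : IsHeegnerPoint (W.conductorNorm ℤ) W K P)
    {c : K ≃ₐ[ℚ] K} (hc : c ≠ 1) (hy : ∀ Q : (W.baseChange K).toAffine.Point, 2 • Q ≠ P)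
    (D : Rank1Residual.P2.KolyvaginMachine.PointSystemFamily (W.conductorNorm ℤ) W K P 2 (CMInert W))
    (R : Rank1Residual.P2.KolyvaginMachine.ReciprocityFamily (W.conductorNorm ℤ) W K 2 (CMInert W)) :
    ∀ s ∈ selmerGroup (W.baseChange K) ((2 ^ 1 : ℕ) : ℤ), conjAct W c ((2 ^ 1 : ℕ) : ℤ) s = s := by
  refine conjAct_eq_self_of_cmInert_two_of_heegner W hCM hin hsurj hK hH hP hc hy (q := 2 ^ 1)
    (pow_one 2) ?_ ?_
  · intro hdiv
    obtain ⟨ε, τ, hτ, A, hA, Pt, hPt, hε, h53, hAτ, hPt1, hm'⟩ :=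
      Rank1Residual.P2.KolyvaginMachine.hpoints_of_pointSystemFamily D le_rfl hdiv c hc
    exact ⟨ε, τ, hτ, A, hA, Pt, hPt, hε, h53, hAτ, hPt1, fun m hm hq ↦
      hm' m hm fun q hq' ↦ ⟨(hq q hq').1, (hq q hq').2,
        cmInert_of_isKolyvaginPrime_two W hCM hin hsurj (hq q hq').1⟩⟩
  · intro ℓ hℓ hF
    exact Rank1Residual.P2.KolyvaginMachine.hRT_of_reciprocityFamily R le_rfl hℓ hF
      (cmInert_of_isKolyvaginPrime_two W hCM hin hsurj hℓ)

end Summit.BirchSwinnertonDyer.BirchSwinnertonDyer.Theorems.KolyvaginDescentTwo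

end
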